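import Literature.AlgebraicGeometry.Frobenioids.ArchimedeanProp35iCounterexampleNA
import Literature.AlgebraicGeometry.Frobenioids.ArchimedeanProp35iCounterexampleStd
import Literature.AlgebraicGeometry.Frobenioids.ArchimedeanProp35iSaturationIff
import Literature.AlgebraicGeometry.Frobenioids.ArchimedeanPointBase
import HarnessLib

/-!
# Frobenioids II, Proposition 3.5 (i) for `H = A` and `H = N`: the universal closures of the typed SCHEMATA
# `ArchFrd.Prop35i_A π`, `ArchFrd.Prop35i_N π` are REFUTED in the kernel — even over a base of RC-STANDARD
# type — and the instances at the bases that occur (purely complex bases; THE one-morphism base of [IUTchI]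
# Example 3.4 (i)) hold with NO hypothesis

Mochizuki, *The geometry of Frobenioids II: poly-Frobenioids*, Kyushu J. Math. **62** (2008) 401–460, §3,
Proposition 3.5 (i), kurims text p. 34 [cite: MochizukiFrdII2008, Prop 3.5 (i) p.34]:
"Let `A ∈ Ob(H)`; suppose that `B_D → A_D := Base(A)` is a mono-minimal categorical quotient of `B_D` by a
group `G_D ⊆ Aut_D(B_D)` in `D`. Then there exists a pull-back morphism `B → A` that lifts `B_D → A_D` and a
group `G ⊆ Aut_H(B)` that maps isomorphically to `G_D` such that `B → A` is a mono-minimal categorical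
quotient of `B` by `G` in `H`" (`H ∈ {C, A, N, R}`, Ex. 3.3); the base at a complex archimedean place in
*Inter-universal Teichmüller theory I*, Example 3.4 (i), kurims p. 80: "the one-morphism category determined by
`Spec(K_v)`" [cite: Mochizuki2012, Ex 3.4 (i) p.80].

PROOF-ONLY companion (theorems only; no `def`, no `instance`) of `ArchimedeanTheoremsInstances.lean` (seat
abc-iut-L1-t9: the typed instances `Prop35i_A`, `Prop35i_N`), of abc-iut-w4-d100's
`ArchimedeanProp35iCounterexampleNA.lean` (`not_prop35i_A_collapse`, `not_prop35i_N_collapse` over the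
Galois-collapsing base `D₀ → D₀`, which is not complexifiable) and `ArchimedeanProp35iSaturationIff.lean`
(`prop35i_A_iff_C`, `prop35i_N_iff_C`, `prop35i_{A,N}_iff_saturated`), and of abc-iut-w5-d013's
`ArchimedeanProp35iCounterexampleStd.lean` (`P35iToy.not_prop35i_C`: the `C`-instance fails over a base of
RC-STANDARD type); cell abc-iut, block F, FACT-LIST rows **F-0857** (`Prop35i_A`) and **F-0859** (`Prop35i_N`),
class R5 ("parametrised schema: universal closure is not a fact; named instances only"; their `C`-twin F-0858
is already so labelled by `not_prop35i_C_collapse`), seat abc-iut-f-013.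

CONTENTS.
* `P35iToy.not_prop35i_A`, `P35iToy.not_prop35i_N` — NEW as typed instances: over abc-iut-w5-d013's toy base
  `T → D₀` (`σ ↦ 𝟙`), which is connected, totally epimorphic and of RC-STANDARD type ([FrdII] Def. 3.1 (v) —
  ALL the standing hypotheses on `D` of Thm. 3.6), the instances of Prop. 3.5 (i) at the angular Frobenioid `A`
  and at the angloid `N` FAIL, by the coincidences `prop35i_A_iff_C` / `prop35i_N_iff_C` (both instances =
  Galois saturation of the base functor) and `P35iToy.not_prop35i_C`; packaged with the base data as
  `P35iToy.exists_counterexample_A/_N` — so, exactly as for `C` (finding P35i-F1), no hypothesis on the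
  CATEGORY `D` repairs the item for `A`/`N`: the repair constrains the FUNCTOR `π` (Galois saturation,
  GAP-LEDGER G-w4d100-1; repaired statements `Prop35iR_A/_N`, proved for every base);
* `not_forall_prop35i_A`, `not_forall_prop35i_N` — the universal closures over `π : D → D₀` are FALSE, and
  `not_forall_prop35i_A_of_isOfRCStandardType`, `not_forall_prop35i_N_of_isOfRCStandardType` — still false
  with «`D` connected, totally epimorphic, of RC-standard type» added as antecedents;
* the instance forms at the bases that occur, hypothesis-free: `prop35i_A_of_forall_isComplex`,
  `prop35i_N_of_forall_isComplex` (no real object ⇒ every quotient datum is Galois-saturated,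
  `galoisSaturated_of_isComplex`) and `prop35i_A_ptBase`, `prop35i_N_ptBase` at THE base of [IUTchI] Ex. 3.4
  (i) (`ArchFrd.ptBase`, value `Spec ℂ`). (The same two instances appear as conjuncts of abc-iut-w4-d100's
  `prop35i_all_of_forall_isComplex` / `prop35i_all_ptBase` in `ArchimedeanProp35iArithmeticBases.lean`, together
  with the FAITHFUL-base case `prop35i_all_of_faithful`; that module is not imported here, the per-row forms
  below are derived directly from the characterisation `prop35i_{A,N}_iff_saturated`.)
Nothing of the paper beyond finding P35i-F1 (already of record) is contradicted; nothing here bears on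
[IUTchIII] Cor. 3.12; typed ≠ proved except where a `theorem` says so.
-/

namespace Literature.AlgebraicGeometry.Frobenioids

open CategoryTheory

noncomputable section

namespace ArchFrd

universe v u

/-! ### The `A`- and `N`-instances fail over a base of RC-standard type -/

namespace P35iToy

/-- **[FrdII] Prop. 3.5 (i) for `H = A` AS TYPED fails over the toy base `T → D₀` of RC-standard type**
(connected, totally epimorphic, RC-connected, complexifiable, FSMFF, RC-iso-subanchor; `π(σ) = 𝟙`): by
`prop35i_A_iff_C` the `A`-instance coincides with the `C`-instance, refuted there by `P35iToy.not_prop35i_C`.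
[cite: MochizukiFrdII2008, Prop 3.5 (i) p.34] -/
theorem not_prop35i_A : ¬ Literature.AlgebraicGeometry.Frobenioids.ArchFrd.Prop35i_A toD0 :=
  fun h => not_prop35i_C ((prop35i_A_iff_C toD0).mp h)

/-- **[FrdII] Prop. 3.5 (i) for `H = N` AS TYPED fails over the toy base `T → D₀` of RC-standard type**:
by `prop35i_N_iff_C` and `P35iToy.not_prop35i_C`. [cite: MochizukiFrdII2008, Prop 3.5 (i) p.34] -/
theorem not_prop35i_N : ¬ Literature.AlgebraicGeometry.Frobenioids.ArchFrd.Prop35i_N toD0 :=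
  fun h => not_prop35i_C ((prop35i_N_iff_C toD0).mp h)

/-- **Finding P35i-F1 for `A` under ALL standing hypotheses on the base, packaged**: there is a connected,
totally epimorphic base `π : D → D₀` of RC-STANDARD type ([FrdII] Def. 3.1 (v)) for which the typed instance
`Prop35i_A π` fails. [cite: MochizukiFrdII2008, Prop 3.5 (i) p.34] -/
theorem exists_counterexample_A :
    ∃ (D : Type) (_ : Category.{0} D) (π : D ⥤ D0),
      IsConnected D ∧ IsTotallyEpimorphic D ∧ RC.IsOfRCStandardType (baseRC π) ∧
        ¬ Literature.AlgebraicGeometry.Frobenioids.ArchFrd.Prop35i_A π :=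
  ⟨T, inferInstance, toD0, T.isConnected, T.isTotallyEpimorphic, isOfRCStandardType, not_prop35i_A⟩

/-- **Finding P35i-F1 for `N` under ALL standing hypotheses on the base, packaged**: there is a connected,
totally epimorphic base `π : D → D₀` of RC-STANDARD type for which the typed instance `Prop35i_N π` fails.
[cite: MochizukiFrdII2008, Prop 3.5 (i) p.34] -/
theorem exists_counterexample_N :
    ∃ (D : Type) (_ : Category.{0} D) (π : D ⥤ D0),
      IsConnected D ∧ IsTotallyEpimorphic D ∧ RC.IsOfRCStandardType (baseRC π) ∧
        ¬ Literature.AlgebraicGeometry.Frobenioids.ArchFrd.Prop35i_N π :=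
  ⟨T, inferInstance, toD0, T.isConnected, T.isTotallyEpimorphic, isOfRCStandardType, not_prop35i_N⟩

end P35iToy

/-! ### The universal closures are false -/

/-- **The universal closure of the typed schema `ArchFrd.Prop35i_A π` is FALSE** (FACT-LIST row F-0857,
class R5): witness the Galois-collapsing base `D₀ → D₀` (abc-iut-w4-d100's `not_prop35i_A_collapse`; a second
witness of RC-standard type is `P35iToy.not_prop35i_A`). Instances: `prop35i_A_ptBase`,
`prop35i_A_of_forall_isComplex` below, `prop35i_all_of_faithful` (faithful bases), and the characterisation
`prop35i_A_iff_saturated`. [cite: MochizukiFrdII2008, Prop 3.5 (i) p.34] -/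
theorem not_forall_prop35i_A :
    ¬ ∀ (D : Type) [Category.{0} D] (π : D ⥤ D0),
        Literature.AlgebraicGeometry.Frobenioids.ArchFrd.Prop35i_A π :=
  fun h => not_prop35i_A_collapse (h D0 D0.collapse)

/-- **The universal closure of the typed schema `ArchFrd.Prop35i_N π` is FALSE** (FACT-LIST row F-0859,
class R5): witness the Galois-collapsing base (abc-iut-w4-d100's `not_prop35i_N_collapse`; RC-standard
witness `P35iToy.not_prop35i_N`). Instances: `prop35i_N_ptBase`, `prop35i_N_of_forall_isComplex`,
`prop35i_all_of_faithful`, characterisation `prop35i_N_iff_saturated`. [cite: MochizukiFrdII2008, Prop 3.5 (i) p.34] -/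
theorem not_forall_prop35i_N :
    ¬ ∀ (D : Type) [Category.{0} D] (π : D ⥤ D0),
        Literature.AlgebraicGeometry.Frobenioids.ArchFrd.Prop35i_N π :=
  fun h => not_prop35i_N_collapse (h D0 D0.collapse)

/-- **The closure of `Prop35i_A` stays false with ALL of [FrdII] Thm. 3.6's standing hypotheses on the base
added** («`D` connected, totally epimorphic, of RC-standard type», Def. 3.1 (v)): the missing hypothesis is
on the functor `π` (Galois saturation), not on the category `D`. [cite: MochizukiFrdII2008, Prop 3.5 (i) p.34] -/
theorem not_forall_prop35i_A_of_isOfRCStandardType :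
    ¬ ∀ (D : Type) [Category.{0} D] (π : D ⥤ D0), IsConnected D → IsTotallyEpimorphic D →
        RC.IsOfRCStandardType (baseRC π) → Literature.AlgebraicGeometry.Frobenioids.ArchFrd.Prop35i_A π :=
  fun h => P35iToy.not_prop35i_A
    (h P35iToy.T P35iToy.toD0 P35iToy.T.isConnected P35iToy.T.isTotallyEpimorphic
      P35iToy.isOfRCStandardType)

/-- **The closure of `Prop35i_N` stays false with ALL of [FrdII] Thm. 3.6's standing hypotheses on the base
added.** [cite: MochizukiFrdII2008, Prop 3.5 (i) p.34] -/
theorem not_forall_prop35i_N_of_isOfRCStandardType :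
    ¬ ∀ (D : Type) [Category.{0} D] (π : D ⥤ D0), IsConnected D → IsTotallyEpimorphic D →
        RC.IsOfRCStandardType (baseRC π) → Literature.AlgebraicGeometry.Frobenioids.ArchFrd.Prop35i_N π :=
  fun h => P35iToy.not_prop35i_N
    (h P35iToy.T P35iToy.toD0 P35iToy.T.isConnected P35iToy.T.isTotallyEpimorphic
      P35iToy.isOfRCStandardType)

/-! ### The instances at the bases that occur — no hypothesis -/

section Instances

variable {D : Type u} [Category.{v} D] (π : D ⥤ D0)

/-- **[FrdII] Prop. 3.5 (i) for `H = A` AS TYPED over a base all of whose objects are complex** (no real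
object ⇒ every mono-minimal quotient datum is Galois-saturated, `galoisSaturated_of_isComplex`; then
`prop35i_A_iff_saturated`). [cite: MochizukiFrdII2008, Prop 3.5 (i) p.34] -/
theorem prop35i_A_of_forall_isComplex (hc : ∀ d : D, (π.obj d).IsComplex) :
    Literature.AlgebraicGeometry.Frobenioids.ArchFrd.Prop35i_A π :=
  (prop35i_A_iff_saturated π).mpr fun _ A _ fD GD _ => galoisSaturated_of_isComplex π fD GD (hc A.snd)

/-- **[FrdII] Prop. 3.5 (i) for `H = N` AS TYPED over a base all of whose objects are complex.**
[cite: MochizukiFrdII2008, Prop 3.5 (i) p.34] -/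
theorem prop35i_N_of_forall_isComplex (hc : ∀ d : D, (π.obj d).IsComplex) :
    Literature.AlgebraicGeometry.Frobenioids.ArchFrd.Prop35i_N π :=
  (prop35i_N_iff_saturated π).mpr fun _ A _ fD GD _ => galoisSaturated_of_isComplex π fD GD (hc A.snd)

end Instances

/-- **[FrdII] Prop. 3.5 (i) for `H = A` AS TYPED at THE base of [IUTchI] Example 3.4 (i)** — the one-morphism
category at `Spec ℂ` (`ArchFrd.ptBase`), i.e. for the angular Frobenioid `A_v`: holds with no hypothesis
(FACT-LIST row F-0857 at the consumed instance). [cite: MochizukiFrdII2008, Prop 3.5 (i) p.34] -/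
theorem prop35i_A_ptBase : Literature.AlgebraicGeometry.Frobenioids.ArchFrd.Prop35i_A ptBase :=
  prop35i_A_of_forall_isComplex ptBase fun _ => rfl

/-- **[FrdII] Prop. 3.5 (i) for `H = N` AS TYPED at THE base of [IUTchI] Example 3.4 (i)** (`ArchFrd.ptBase`),
i.e. for the angloid `N_v`: holds with no hypothesis (FACT-LIST row F-0859 at the consumed instance).
[cite: MochizukiFrdII2008, Prop 3.5 (i) p.34] -/
theorem prop35i_N_ptBase : Literature.AlgebraicGeometry.Frobenioids.ArchFrd.Prop35i_N ptBase :=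
  prop35i_N_of_forall_isComplex ptBase fun _ => rfl

end ArchFrd

end

end Literature.AlgebraicGeometry.Frobenioids
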